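import Summits.AtomisticToContinuum.HydrodynamicLimit.Theorems.CollisionIsometryCLTMacroClosureStubBlockMGFGauss
import HarnessLib

/-!
# Stub `stub_blockMGF` of the line `IdeatorTwoGen1Sketch` (crux `MacroClosure`, stmt-14870), part 2:
# the weighted Helmert–Chernoff bound for block temperatures (registered sub-goal `stub_blockMGF_kinetic`)

Proof file (`--supports stmt-AtomisticToContinuum-14870`) for the registered sub-goal
`stub_blockMGF_kinetic` of `Barycentric.stub_blockMGF : HomogeneousBlockMGF`: the COLD-BLOCK velocity
large-deviation input. For a block with non-negative weights `wᵢ = φ(xᵢ − x)` (positions fixed) the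
block temperature is `θ̄ = Q_w(v)/(3W)` with `W = Σ wᵢ` and the weighted sum of squares about the
weighted mean `Q_w(v) = Σ wᵢ‖vᵢ‖² − ‖Σ wᵢvᵢ‖²/W` (`stateTemp_bU`, `block_sums`), and under the
homogeneous law the velocities are i.i.d. `N(u, θ id)` given the positions
(`localGibbsMeasure_rung0_eq_map`). We prove, for every `λ ≥ 0`, WITHOUT rotation invariance or
Cochran's theorem,

`E exp(−λ Q_w/θ) ≤ ∏ₖ (1 + 2λ aₖ)^{−3/2}`, `aₖ = wₖ S_{>k}/S_{≥k}`, `S_{≥k} = Σ_{j ≥ k} wⱼ`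

(`lintegral_exp_neg_wss_le`): the weighted Helmert recursion
`Q_{(w₀,w')}(x, y) = Q_{w'}(y) + (w₀W'/(w₀+W')) ‖x − ȳ_{w'}‖²` (`helmert_step`) peels off one particle
at a time, the new particle being integrated FIRST against `N(u, θ id)` by the one-step bound of
part 1 (`lintegral_exp_neg_mul_norm_sub_sq_gaussMeasure_le`, uniform in the centre `ȳ_{w'}`), and
Tonelli over `(ℝ³)^{n+1} ≅ ℝ³ × (ℝ³)ⁿ` (`measurePreserving_piFinSuccAbove`). For weights `≤ 1`,
Bernoulli's inequality turns the product into `(1 + 2λ)^{−(3/2)(W − D)}` with the deficiency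
`D = Σₖ wₖ²/S_{≥k}` (`≤ 1 + log n` for unit weights): a `χ²` law with `3(W − D)` effective degrees of
freedom dominates `Q_w/θ` in the Laplace order, whence the Chernoff small-ball bound
`P(Q_w ≤ 3sθ(W − D)) ≤ exp(−(3/2)(W − D)(s − 1 − log s))` (`0 < s ≤ 1`) with the sharp `χ²` rate
function — cold blocks of `n` particles cost `θ̄^{(3/2)(n − O(log n))}`, which is what makes the
sub-unit tilt `γ' < 1` of `HomogeneousBlockMGF` integrable eventually.
-/

noncomputable section

open MeasureTheory Filter Set Topology InformationTheory ProbabilityTheory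
open scoped ENNReal ContDiff InnerProductSpace

namespace Summit.AtomisticToContinuum.HydrodynamicLimit.Theorems.MacroClosureLine

open Literature.MathematicalPhysics.KineticTheory Literature.Analysis.FluidPDE
open Literature.Analysis.FunctionSpaces

namespace Barycentric

/-! ## The weighted Helmert step -/

/-- **Weighted Helmert identity** (one step): adjoining a particle of weight `w₀ ≥ 0` and velocity
`x` to a block of total weight `W' ≥ 0`, weighted momentum `M'` and weighted kinetic sum `A'`,
`(w₀‖x‖² + A') − ‖w₀x + M'‖²/(w₀ + W') = (A' − ‖M'‖²/W') + (w₀W'/(w₀ + W')) ‖x − M'/W'‖²`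
(with the junk conventions of `/` when `W' = 0`, in which case `A' = 0`, `M' = 0`). [folklore] -/
theorem helmert_step {w₀ W' A' : ℝ} (x M' : V3) (hw₀ : 0 ≤ w₀) (hW' : 0 ≤ W')
    (hdeg : W' = 0 → A' = 0 ∧ M' = 0) :
    (w₀ * ‖x‖ ^ 2 + A') - ‖w₀ • x + M'‖ ^ 2 / (w₀ + W') =
      (A' - ‖M'‖ ^ 2 / W') + w₀ * W' / (w₀ + W') * ‖x - W'⁻¹ • M'‖ ^ 2 := by
  rcases hW'.eq_or_lt with h | h
  · obtain ⟨hA, hM⟩ := hdeg h.symm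
    rw [hA, hM, ← h]
    simp only [add_zero, smul_zero, sub_zero, norm_zero, ne_eq, OfNat.ofNat_ne_zero,
      not_false_eq_true, zero_pow, zero_div, mul_zero, zero_mul, div_zero, norm_smul, mul_pow,
      Real.norm_eq_abs, sq_abs]
    by_cases hw : w₀ = 0
    · simp [hw]
    · field_simp
      ring
  · have hW : w₀ + W' ≠ 0 := by linarith
    rw [norm_add_sq_real, norm_sub_sq_real, real_inner_smul_left, real_inner_smul_right, norm_smul,
      norm_smul, mul_pow, mul_pow, Real.norm_eq_abs, Real.norm_eq_abs, sq_abs, sq_abs]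
    field_simp
    ring

/-! ## Tonelli over `(ℝ³)^{n+1} ≅ ℝ³ × (ℝ³)ⁿ` -/

/-- `(x, y) ↦ Fin.cons x y` is measurable. [folklore] -/
theorem measurable_finCons (n : ℕ) :
    Measurable fun p : V3 × (Fin n → V3) => (Fin.cons p.1 p.2 : Fin (n + 1) → V3) := by
  have h := (MeasurableEquiv.piFinSuccAbove (fun _ : Fin (n + 1) => V3) 0).symm.measurable
  have hfun : ⇑(MeasurableEquiv.piFinSuccAbove (fun _ : Fin (n + 1) => V3) 0).symm =
      fun p : V3 × (Fin n → V3) => (Fin.cons p.1 p.2 : Fin (n + 1) → V3) := by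
    funext p
    rw [MeasurableEquiv.piFinSuccAbove_symm_apply]
    exact Fin.insertNth_zero' p.1 p.2
  rwa [hfun] at h

/-- **Tonelli, first particle innermost**: for a σ-finite law `γ` on `ℝ³` and measurable `F ≥ 0` on
`(ℝ³)^{n+1}`, `∫ F dγ^{⊗(n+1)} = ∫ γ^{⊗n}(dy) ∫ γ(dx) F(x :: y)`. [folklore] -/
theorem lintegral_pi_succ_cons {γ : Measure V3} [SigmaFinite γ] {n : ℕ}
    {F : (Fin (n + 1) → V3) → ℝ≥0∞} (hF : Measurable F) :
    ∫⁻ v, F v ∂(Measure.pi fun _ : Fin (n + 1) => γ) =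
      ∫⁻ y, ∫⁻ x, F (Fin.cons x y) ∂γ ∂(Measure.pi fun _ : Fin n => γ) := by
  have hmp := measurePreserving_piFinSuccAbove (fun _ : Fin (n + 1) => γ) 0
  set e := MeasurableEquiv.piFinSuccAbove (fun _ : Fin (n + 1) => V3) 0 with he
  have hcons : ∀ p : V3 × (Fin n → V3), e.symm p = Fin.cons p.1 p.2 := by
    intro p
    rw [he, MeasurableEquiv.piFinSuccAbove_symm_apply]
    exact Fin.insertNth_zero' p.1 p.2
  have h1 : ∫⁻ v, F v ∂(Measure.pi fun _ : Fin (n + 1) => γ) =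
      ∫⁻ p, F (e.symm p) ∂(γ.prod (Measure.pi fun _ : Fin n => γ)) :=
    MeasurePreserving.lintegral_map_equiv F e.symm hmp.symm
  rw [h1]
  simp_rw [hcons]
  exact lintegral_prod_symm _ ((hF.comp (measurable_finCons n)).aemeasurable)

/-! ## Suffix sums -/

/-- Suffix sums past the adjoined particle: `S_{>0}(w) = Σᵢ w(i+1)`. [folklore] -/
theorem suffix_gt_zero {n : ℕ} (w : Fin (n + 1) → ℝ) :
    (∑ j, if (0 : Fin (n + 1)) < j then w j else 0) = ∑ i : Fin n, w i.succ := by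
  rw [Fin.sum_univ_succ]
  simp [Fin.succ_pos]

/-- Suffix sums from the adjoined particle: `S_{≥0}(w) = w 0 + Σᵢ w(i+1)`. [folklore] -/
theorem suffix_ge_zero {n : ℕ} (w : Fin (n + 1) → ℝ) :
    (∑ j, if (0 : Fin (n + 1)) ≤ j then w j else 0) = w 0 + ∑ i : Fin n, w i.succ := by
  rw [Fin.sum_univ_succ]
  simp

/-- Suffix sums of the tail: `S_{>i+1}(w) = S_{>i}(w ∘ succ)`. [folklore] -/
theorem suffix_gt_succ {n : ℕ} (w : Fin (n + 1) → ℝ) (i : Fin n) :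
    (∑ j, if i.succ < j then w j else 0) = ∑ j : Fin n, if i < j then w j.succ else 0 := by
  rw [Fin.sum_univ_succ]
  simp [Fin.succ_lt_succ_iff]

/-- Suffix sums of the tail: `S_{≥i+1}(w) = S_{≥i}(w ∘ succ)`. [folklore] -/
theorem suffix_ge_succ {n : ℕ} (w : Fin (n + 1) → ℝ) (i : Fin n) :
    (∑ j, if i.succ ≤ j then w j else 0) = ∑ j : Fin n, if i ≤ j then w j.succ else 0 := by
  rw [Fin.sum_univ_succ]
  simp [Fin.succ_le_succ_iff, Fin.succ_ne_zero]

/-! ## The weighted Helmert–Chernoff bound -/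

/-- **Weighted Helmert–Chernoff bound.** For non-negative weights `w` on `n` particles with i.i.d.
velocities `N(u, θ id)`, `θ > 0`, and every `λ ≥ 0`,
`E exp(−(λ/θ) Q_w) ≤ ∏ₖ (1 + 2λ wₖ S_{>k}/S_{≥k})^{−3/2}`, where
`Q_w(v) = Σ wᵢ‖vᵢ‖² − ‖Σ wᵢvᵢ‖²/Σ wᵢ` is the weighted sum of squares about the weighted mean and
`S_{≥k} = Σ_{j ≥ k} wⱼ`, `S_{>k} = Σ_{j > k} wⱼ` (label order). Induction on `n` by the weighted
Helmert step, the new particle integrated first. [folklore] -/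
theorem lintegral_exp_neg_wss_le (u : V3) {θ : ℝ} (hθ : 0 < θ) {l : ℝ} (hl : 0 ≤ l) :
    ∀ (n : ℕ) (w : Fin n → ℝ), (∀ i, 0 ≤ w i) →
      ∫⁻ v, ENNReal.ofReal (Real.exp (-(l / θ) *
          ((∑ i, w i * ‖v i‖ ^ 2) - ‖∑ i, w i • v i‖ ^ 2 / ∑ i, w i)))
        ∂(Measure.pi fun _ : Fin n => gaussMeasure u θ) ≤
      ENNReal.ofReal (∏ k, (1 + 2 * l * (w k * (∑ j, if k < j then w j else 0) /
        ∑ j, if k ≤ j then w j else 0)) ^ (-(3 : ℝ) / 2)) := by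
  intro n
  induction n with
  | zero =>
    intro w _
    simp
  | succ n ih =>
    intro w hw
    -- the tail block
    set W' : ℝ := ∑ i : Fin n, w (Fin.succ i) with hW'
    have hW'0 : 0 ≤ W' := Finset.sum_nonneg fun i _ => hw i.succ
    set a₀ : ℝ := w 0 * W' / (w 0 + W') with ha₀
    have ha₀0 : 0 ≤ a₀ := by
      rw [ha₀]
      exact div_nonneg (mul_nonneg (hw 0) hW'0) (add_nonneg (hw 0) hW'0)
    -- the integrand and its measurability
    set F : (Fin (n + 1) → V3) → ℝ≥0∞ := fun v => ENNReal.ofReal (Real.exp (-(l / θ) *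
        ((∑ i, w i * ‖v i‖ ^ 2) - ‖∑ i, w i • v i‖ ^ 2 / ∑ i, w i))) with hF
    have hFm : Measurable F := by
      have hc : Continuous fun v : Fin (n + 1) → V3 => Real.exp (-(l / θ) *
          ((∑ i, w i * ‖v i‖ ^ 2) - ‖∑ i, w i • v i‖ ^ 2 / ∑ i, w i)) := by
        fun_prop
      exact ENNReal.measurable_ofReal.comp hc.measurable
    -- the tail statistics
    set G : (Fin n → V3) → ℝ≥0∞ := fun y => ENNReal.ofReal (Real.exp (-(l / θ) *
        ((∑ i, w i.succ * ‖y i‖ ^ 2) - ‖∑ i, w i.succ • y i‖ ^ 2 / ∑ i : Fin n, w i.succ))) with hG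
    -- Helmert splitting of the integrand
    have hsplit : ∀ (x : V3) (y : Fin n → V3), F (Fin.cons x y) =
        G y * ENNReal.ofReal (Real.exp (-(l * a₀ / θ) * ‖x - W'⁻¹ • ∑ i, w i.succ • y i‖ ^ 2)) := by
      intro x y
      rw [hF, hG]
      dsimp only
      rw [← ENNReal.ofReal_mul (Real.exp_pos _).le, ← Real.exp_add]
      congr 1
      rw [Fin.sum_univ_succ, Fin.sum_univ_succ, Fin.sum_univ_succ]
      simp only [Fin.cons_zero, Fin.cons_succ]
      have hdeg : W' = 0 → (∑ i, w i.succ * ‖y i‖ ^ 2) = 0 ∧ (∑ i, w i.succ • y i) = 0 := by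
        intro h0
        have hz : ∀ i ∈ (Finset.univ : Finset (Fin n)), w i.succ = 0 :=
          (Finset.sum_eq_zero_iff_of_nonneg fun (i : Fin n) _ => hw i.succ).1 h0
        refine ⟨Finset.sum_eq_zero fun i hi => ?_, Finset.sum_eq_zero fun i hi => ?_⟩
        · rw [hz i hi, zero_mul]
        · rw [hz i hi, zero_smul]
      rw [← hW', helmert_step x _ (hw 0) hW'0 hdeg, ha₀]
      ring
    -- Tonelli, the new particle innermost, and the one-step Gaussian bound
    have hinner : ∀ y : Fin n → V3, ∫⁻ x, F (Fin.cons x y) ∂(gaussMeasure u θ) ≤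
        G y * ENNReal.ofReal ((1 + 2 * l * a₀) ^ (-(3 : ℝ) / 2)) := by
      intro y
      simp_rw [hsplit]
      rw [lintegral_const_mul' _ _ ENNReal.ofReal_ne_top]
      refine mul_le_mul' le_rfl ?_
      have h := lintegral_exp_neg_mul_norm_sub_sq_gaussMeasure_le u (W'⁻¹ • ∑ i, w i.succ • y i) hθ
        (show 0 ≤ l * a₀ / θ from div_nonneg (mul_nonneg hl ha₀0) hθ.le)
      have e : 1 + 2 * (l * a₀ / θ) * θ = 1 + 2 * l * a₀ := by
        field_simp
      rwa [e] at h
    have hK : ENNReal.ofReal ((1 + 2 * l * a₀) ^ (-(3 : ℝ) / 2)) ≠ ⊤ := ENNReal.ofReal_ne_top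
    calc ∫⁻ v, F v ∂(Measure.pi fun _ : Fin (n + 1) => gaussMeasure u θ)
        = ∫⁻ y, ∫⁻ x, F (Fin.cons x y) ∂(gaussMeasure u θ)
            ∂(Measure.pi fun _ : Fin n => gaussMeasure u θ) := lintegral_pi_succ_cons hFm
      _ ≤ ∫⁻ y, G y * ENNReal.ofReal ((1 + 2 * l * a₀) ^ (-(3 : ℝ) / 2))
            ∂(Measure.pi fun _ : Fin n => gaussMeasure u θ) := lintegral_mono hinner
      _ = (∫⁻ y, G y ∂(Measure.pi fun _ : Fin n => gaussMeasure u θ)) *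
            ENNReal.ofReal ((1 + 2 * l * a₀) ^ (-(3 : ℝ) / 2)) := lintegral_mul_const' _ _ hK
      _ ≤ ENNReal.ofReal (∏ k : Fin n, (1 + 2 * l * (w k.succ *
              (∑ j : Fin n, if k < j then w j.succ else 0) /
              ∑ j : Fin n, if k ≤ j then w j.succ else 0)) ^ (-(3 : ℝ) / 2)) *
            ENNReal.ofReal ((1 + 2 * l * a₀) ^ (-(3 : ℝ) / 2)) := by
          refine mul_le_mul' ?_ le_rfl
          have h := ih (fun i : Fin n => w i.succ) (fun i : Fin n => hw i.succ)
          exact h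
      _ = ENNReal.ofReal (∏ k, (1 + 2 * l * (w k * (∑ j, if k < j then w j else 0) /
            ∑ j, if k ≤ j then w j else 0)) ^ (-(3 : ℝ) / 2)) := by
          have hpos : ∀ k : Fin n, 0 ≤ (1 + 2 * l * (w k.succ *
              (∑ j : Fin n, if k < j then w j.succ else 0) /
              ∑ j : Fin n, if k ≤ j then w j.succ else 0)) ^ (-(3 : ℝ) / 2) := by
            intro k
            refine Real.rpow_nonneg ?_ _
            refine add_nonneg zero_le_one (mul_nonneg (mul_nonneg zero_le_two hl) ?_)
            refine div_nonneg (mul_nonneg (hw _) (Finset.sum_nonneg fun j _ => ?_))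
              (Finset.sum_nonneg fun j _ => ?_)
            · split_ifs
              · exact hw _
              · exact le_rfl
            · split_ifs
              · exact hw _
              · exact le_rfl
          rw [← ENNReal.ofReal_mul (Finset.prod_nonneg fun k _ => hpos k), Fin.prod_univ_succ,
            suffix_gt_zero, suffix_ge_zero, mul_comm]
          congr 1
          congr 1
          refine Finset.prod_congr rfl fun k _ => ?_
          rw [suffix_gt_succ, suffix_ge_succ]

/-- **`stub_blockMGF_kinetic`** (registered sub-goal of `stub_blockMGF`): the weighted
Helmert–Chernoff bound — under the velocity marginal `⊗ᵢ N(u, θ id)` of the homogeneous local Gibbs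
law (positions fixed, block weights `wᵢ = φ(xᵢ − x) ≥ 0`), the Laplace transform of the weighted sum
of squares about the weighted mean `Q_w = 3Wθ̄` (`W = Σwᵢ = (N+1)ρ̄`, `θ̄` the block temperature) is
dominated factor by factor: `E exp(−(λ/θ)Q_w) ≤ ∏ₖ (1 + 2λ wₖS_{>k}/S_{≥k})^{−3/2}` for all
`λ ≥ 0`. [folklore] -/
theorem stub_blockMGF_kinetic : ∀ (n : ℕ) (w : Fin n → ℝ), (∀ i, 0 ≤ w i) → ∀ (u : V3) (θ : ℝ), 0 < θ → ∀ l : ℝ, 0 ≤ l → ∫⁻ v, ENNReal.ofReal (Real.exp (-(l / θ) * ((∑ i, w i * ‖v i‖ ^ 2) - ‖∑ i, w i • v i‖ ^ 2 / ∑ i, w i))) ∂(Measure.pi fun _ : Fin n => gaussMeasure u θ) ≤ ENNReal.ofReal (∏ k, (1 + 2 * l * (w k * (∑ j, if k < j then w j else 0) / ∑ j, if k ≤ j then w j else 0)) ^ (-(3 : ℝ) / 2)) :=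
  fun n w hw u _ hθ _ hl => lintegral_exp_neg_wss_le u hθ hl n w hw

end Barycentric

end Summit.AtomisticToContinuum.HydrodynamicLimit.Theorems.MacroClosureLine

end
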